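import Literature.Analysis.Complex.ArgumentPrincipleEdgeZeros
import HarnessLib

/-!
# Phase cells — an abstract zero-exclusion lemma for functions real on an axis

THEORY NOTE #2 companion (rh-jensen-theory g10, route `JensenLogBand`, supports the BAND crux
`XiDerivBandRealAllRates`): the ABSTRACT phase-cell lemmas behind `band/NEAR-ZONE-PHASE-CELLS.md`,
typed and PROVED over the tree's left-edge argument principle
(`Literature.Analysis.Complex.integral_re_logDeriv_left_add_finsum_eq`). ζ-free and reusable:

* `noZero_of_leftEdge_count` — the cell count: left-edge variation `0`, horizontal swings `≤ θ₁, θ₂`,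
  right-edge variation `≤ π m + E`, at least `m` axis zeros, `θ₁ + θ₂ + E < 2π` ⟹ no interior zero;
* `re_logDeriv_axis_eq_zero` — `f` real on the imaginary axis ⟹ `Re (f′/f) = 0` there;
* `axis_zero_count_of_alternation` — `m + 1` strictly alternating axis values ⟹ `≥ m` axis zeros
  (with multiplicity);
* `horizontal_swing_le_of_cone` — values in a cone of half-angle `θ < π/2` along a horizontal
  edge ⟹ non-vanishing there and `|Im ∫ f′/f| ≤ 2θ`.

All four are sorry-free (farm rc 0). Intended landing (by a prover hand, verbatim up to the
namespace): `Theorems/JensenLogBandPhaseCell.lean`, `--supports stmt-RiemannHypothesis-19913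
--as helper`. Nothing here bears on RH.
-/

-- single-problem summit: `Summit.RiemannHypothesis.RiemannHypothesis.…` is the tree convention
set_option linter.dupNamespace false

open Complex Set MeasureTheory intervalIntegral

namespace Summit.RiemannHypothesis.RiemannHypothesis.Theorems.JensenPolynomials.LogBand.PhaseCell

/-- **Phase-cell lemma (abstract).** `f` analytic on the closed cell `[0, a₀] × [T₁, T₂]`, with
vanishing continuous argument variation up the left edge (e.g. `f` real there), non-zero on the
other three edges, horizontal argument swings bounded by `θ₁, θ₂`, right-edge variation at most
`π m + E`, and at least `m` zeros (with multiplicity) on the open left edge: if `θ₁ + θ₂ + E < 2π`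
then `f` has NO zero inside the cell. (`2π N_int = Im∫_bot − Im∫_top + ∫_right Re − ∫_left Re − π N_axis`.) -/
theorem noZero_of_leftEdge_count {f : ℂ → ℂ} {a₀ T₁ T₂ θ₁ θ₂ E : ℝ} {m : ℕ}
    (ha : 0 < a₀) (hT : T₁ < T₂)
    (hf : AnalyticOnNhd ℂ f (Icc 0 a₀ ×ℂ Icc T₁ T₂))
    (h_bot : ∀ x ∈ Icc 0 a₀, f (x + T₁ * I) ≠ 0) (h_top : ∀ x ∈ Icc 0 a₀, f (x + T₂ * I) ≠ 0)
    (h_right : ∀ y ∈ Icc T₁ T₂, f (a₀ + y * I) ≠ 0)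
    (h_left : (∫ y in T₁..T₂, (deriv f ((0 : ℝ) + y * I) / f ((0 : ℝ) + y * I)).re) = 0)
    (hbot : |(∫ x in (0 : ℝ)..a₀, deriv f (x + T₁ * I) / f (x + T₁ * I)).im| ≤ θ₁)
    (htop : |(∫ x in (0 : ℝ)..a₀, deriv f (x + T₂ * I) / f (x + T₂ * I)).im| ≤ θ₂)
    (hright : (∫ y in T₁..T₂, (deriv f (a₀ + y * I) / f (a₀ + y * I)).re) ≤ Real.pi * m + E)
    (haxis : (m : ℝ) ≤ ∑ᶠ t ∈ {t : ℝ | f ((0 : ℝ) + t * I) = 0 ∧ t ∈ Ioo T₁ T₂},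
          ((meromorphicOrderAt f ((0 : ℝ) + t * I)).untop₀ : ℝ))
    (hsum : θ₁ + θ₂ + E < 2 * Real.pi) :
    ∀ ρ ∈ Ioo 0 a₀ ×ℂ Ioo T₁ T₂, f ρ ≠ 0 := by
  intro ρ hρ hρ0
  have hid := Literature.Analysis.Complex.integral_re_logDeriv_left_add_finsum_eq ha hT hf h_bot
    h_top h_right
  have hcorner : (((0 : ℝ) : ℂ) + T₁ * I) ∈ Icc 0 a₀ ×ℂ Icc T₁ T₂ :=
    ⟨by simpa using ha.le, by simpa using hT.le⟩
  have hw : f ((0 : ℝ) + T₁ * I) ≠ 0 := h_bot 0 ⟨le_rfl, ha.le⟩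
  have hfin := Literature.Analysis.Complex.finite_zeros_reProdIm ha.le hT.le hf hcorner hw
  have hρK : ρ ∈ Icc 0 a₀ ×ℂ Icc T₁ T₂ := ⟨Ioo_subset_Icc_self hρ.1, Ioo_subset_Icc_self hρ.2⟩
  have hterm_nonneg : ∀ ρ' ∈ hfin.toFinset, (0 : ℝ) ≤ ((meromorphicOrderAt f ρ').untop₀ : ℝ) := by
    intro ρ' hρ'
    rw [Set.Finite.mem_toFinset] at hρ'
    have hρ'K : ρ' ∈ Icc 0 a₀ ×ℂ Icc T₁ T₂ :=
      ⟨Ioo_subset_Icc_self hρ'.2.1, Ioo_subset_Icc_self hρ'.2.2⟩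
    rw [(hf ρ' hρ'K).meromorphicOrderAt_eq]
    cases h : analyticOrderAt f ρ' with
    | top => simp
    | coe n => simp
  have hterm_ρ : (1 : ℝ) ≤ ((meromorphicOrderAt f ρ).untop₀ : ℝ) := by
    have hne := Literature.Analysis.Complex.analyticOrderAt_ne_top_of_reProdIm ha.le hT.le hf
      hcorner hw hρK
    rw [(hf ρ hρK).meromorphicOrderAt_eq]
    cases h : analyticOrderAt f ρ with
    | top => exact absurd h hne
    | coe n =>
      have hn : n ≠ 0 := by
        intro hn0
        rw [hn0] at h
        exact ((hf ρ hρK).analyticOrderAt_eq_zero.mp (by exact_mod_cast h)) hρ0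
      have h1 : (1 : ℝ) ≤ n := by exact_mod_cast Nat.one_le_iff_ne_zero.mpr hn
      simpa using h1
  have hNint : (1 : ℝ) ≤ ∑ᶠ ρ' ∈ {ρ' : ℂ | f ρ' = 0 ∧ ρ' ∈ Ioo 0 a₀ ×ℂ Ioo T₁ T₂},
      ((meromorphicOrderAt f ρ').untop₀ : ℝ) := by
    rw [finsum_mem_eq_finite_toFinset_sum _ hfin]
    have hmem : ρ ∈ hfin.toFinset := by
      rw [Set.Finite.mem_toFinset]
      exact ⟨hρ0, hρ⟩
    exact hterm_ρ.trans (Finset.single_le_sum hterm_nonneg hmem)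
  have hb := (abs_le.mp hbot).2
  have ht := (abs_le.mp htop).1
  have hπ := Real.pi_pos
  have h3 : Real.pi * (m : ℝ) ≤ Real.pi * ∑ᶠ t ∈ {t : ℝ | f ((0 : ℝ) + t * I) = 0 ∧ t ∈ Ioo T₁ T₂},
      ((meromorphicOrderAt f ((0 : ℝ) + t * I)).untop₀ : ℝ) :=
    mul_le_mul_of_nonneg_left haxis hπ.le
  have h4 : 2 * Real.pi * 1 ≤ 2 * Real.pi * ∑ᶠ ρ' ∈ {ρ' : ℂ | f ρ' = 0 ∧ ρ' ∈ Ioo 0 a₀ ×ℂ Ioo T₁ T₂},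
      ((meromorphicOrderAt f ρ').untop₀ : ℝ) :=
    mul_le_mul_of_nonneg_left hNint (by positivity)
  rw [h_left] at hid
  linarith

/-- **Left edge: real values kill the continuous argument.** If `f` is real on the imaginary axis
then `Re (f'/f)(it) = 0` at every axis point (so `h_left` above holds: the integrand vanishes
identically; at axis zeros the quotient is the junk value `0`). -/
theorem re_logDeriv_axis_eq_zero {f : ℂ → ℂ} {t : ℝ} (hf : DifferentiableAt ℂ f (t * I))
    (hreal : ∀ s : ℝ, (f (s * I)).im = 0) :
    (deriv f (t * I) / f (t * I)).re = 0 := by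
  -- G s := f (s i) is a real-valued function of the real variable s with derivative f'(t i)·i
  have hg : HasDerivAt (fun z : ℂ ↦ f (z * I)) (deriv f (t * I) * I) (t : ℂ) := by
    have h1 : HasDerivAt (fun z : ℂ ↦ z * I) I (t : ℂ) := by
      simpa using (hasDerivAt_id (t : ℂ)).mul_const I
    have h2 : HasDerivAt f (deriv f (t * I)) ((t : ℂ) * I) := hf.hasDerivAt
    have := h2.comp (t : ℂ) h1
    simpa [Function.comp_def, mul_comm] using this
  have hG : HasDerivAt (fun s : ℝ ↦ f (s * I)) (deriv f (t * I) * I) t := hg.comp_ofReal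
  have hIm : HasDerivAt (fun s : ℝ ↦ (f (s * I)).im) ((deriv f (t * I) * I).im) t := by
    have := Complex.imCLM.hasFDerivAt.comp_hasDerivAt t hG
    simpa [Function.comp_def] using this
  have hconst : HasDerivAt (fun s : ℝ ↦ (f (s * I)).im) 0 t := by
    have : (fun s : ℝ ↦ (f (s * I)).im) = fun _ ↦ 0 := funext hreal
    rw [this]
    exact hasDerivAt_const t 0
  have hre : (deriv f (t * I)).re = 0 := by
    have := hIm.unique hconst
    simpa using this
  have him : (f (t * I)).im = 0 := hreal t
  rw [Complex.div_re, hre, him]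
  simp

/-- **Axis zeros from sign alternation.** `m + 1` axis points `T₁ < t₀ < … < t_m < T₂` at which the
(real) values of `f` alternate strictly in sign give at least `m` zeros, with multiplicity, on the
open left edge (IVT + multiplicity ≥ 1; `f` analytic hence continuous, real on the axis). -/
theorem axis_zero_count_of_alternation {f : ℂ → ℂ} {a₀ T₁ T₂ : ℝ} {m : ℕ} (ha : 0 ≤ a₀)
    (hT : T₁ < T₂) (hf : AnalyticOnNhd ℂ f (Icc 0 a₀ ×ℂ Icc T₁ T₂))
    (hreal : ∀ s : ℝ, (f (s * I)).im = 0) (hcorner : f ((0 : ℝ) + T₁ * I) ≠ 0)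
    (t : Fin (m + 1) → ℝ) (ht : StrictMono t) (ht₁ : T₁ < t 0) (ht₂ : t (Fin.last m) < T₂)
    (halt : ∀ j : Fin m, (f ((t j.castSucc : ℝ) * I)).re * (f ((t j.succ : ℝ) * I)).re < 0) :
    (m : ℝ) ≤ ∑ᶠ s ∈ {s : ℝ | f ((0 : ℝ) + s * I) = 0 ∧ s ∈ Ioo T₁ T₂},
          ((meromorphicOrderAt f ((0 : ℝ) + s * I)).untop₀ : ℝ) := by
  have e0 : ∀ s : ℝ, (((0 : ℝ) : ℂ) + s * I) = (s : ℂ) * I := fun s ↦ by simp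
  -- every t j lies in (T₁, T₂)
  have ht_lo : ∀ j : Fin (m + 1), T₁ < t j := fun j ↦
    lt_of_lt_of_le ht₁ (ht.monotone (Fin.zero_le j))
  have ht_hi : ∀ j : Fin (m + 1), t j < T₂ := fun j ↦
    lt_of_le_of_lt (ht.monotone (Fin.le_last j)) ht₂
  -- axis points are in the closed rectangle; f is continuous there
  have hmem : ∀ s ∈ Icc T₁ T₂, ((s : ℂ) * I) ∈ Icc 0 a₀ ×ℂ Icc T₁ T₂ := fun s hs ↦
    ⟨by simpa using ha, by simpa using hs⟩
  have hcont : ∀ s ∈ Icc T₁ T₂, ContinuousAt (fun u : ℝ ↦ (f (u * I)).re) s := by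
    intro s hs
    have h1 : ContinuousAt f ((s : ℂ) * I) := (hf _ (hmem s hs)).continuousAt
    have h2 : ContinuousAt (fun u : ℝ ↦ (u : ℂ) * I) s := by fun_prop
    exact Complex.continuous_re.continuousAt.comp (ContinuousAt.comp (by simpa using h1) h2)
  -- IVT on each gap
  have hzero : ∀ j : Fin m, ∃ s, s ∈ Ioo (t j.castSucc) (t j.succ) ∧ f ((s : ℂ) * I) = 0 := by
    intro j
    have hlt : t j.castSucc < t j.succ := ht (Fin.castSucc_lt_succ (i := j))
    have hsub : Icc (t j.castSucc) (t j.succ) ⊆ Icc T₁ T₂ := Icc_subset_Icc (ht_lo _).le (ht_hi _).le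
    have hc : ContinuousOn (fun u : ℝ ↦ (f (u * I)).re) (Icc (t j.castSucc) (t j.succ)) :=
      fun u hu ↦ (hcont u (hsub hu)).continuousWithinAt
    set φ := fun u : ℝ ↦ (f (u * I)).re with hφ
    have hprod := halt j
    have key : ∃ s ∈ Icc (t j.castSucc) (t j.succ), φ s = 0 := by
      rcases mul_neg_iff.mp hprod with ⟨hpos, hneg⟩ | ⟨hneg, hpos⟩
      · have := intermediate_value_Icc' hlt.le hc
        exact this ⟨hneg.le, hpos.le⟩
      · have := intermediate_value_Icc hlt.le hc
        exact this ⟨hneg.le, hpos.le⟩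
    obtain ⟨s, hs, hs0⟩ := key
    have hsa : s ≠ t j.castSucc := by
      intro h; rw [h] at hs0
      have := halt j; rw [show (f (↑(t j.castSucc) * I)).re = 0 from hs0] at this; simp at this
    have hsb : s ≠ t j.succ := by
      intro h; rw [h] at hs0
      have := halt j; rw [show (f (↑(t j.succ) * I)).re = 0 from hs0] at this; simp at this
    refine ⟨s, ⟨lt_of_le_of_ne hs.1 (Ne.symm hsa), lt_of_le_of_ne hs.2 hsb⟩, ?_⟩
    exact Complex.ext (by simpa [hφ] using hs0) (by simpa using hreal s)
  choose sz hsz_mem hsz_zero using hzero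
  -- the zeros are strictly increasing in j, hence distinct
  have hsz_mono : StrictMono sz := by
    intro j k hjk
    have h1 : sz j < t j.succ := (hsz_mem j).2
    have h2 : t k.castSucc < sz k := (hsz_mem k).1
    have h3 : t j.succ ≤ t k.castSucc :=
      ht.monotone (Fin.castSucc_lt_iff_succ_le.mp (Fin.castSucc_lt_castSucc_iff.mpr hjk))
    linarith
  -- the zero set on the open left edge is finite and contains the image of sz
  have hcorner' : (((0 : ℝ) : ℂ) + T₁ * I) ∈ Icc 0 a₀ ×ℂ Icc T₁ T₂ :=
    ⟨by simpa using ha, by simpa using hT.le⟩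
  have hfin : {s : ℝ | f ((0 : ℝ) + s * I) = 0 ∧ s ∈ Ioo T₁ T₂}.Finite :=
    (Literature.Analysis.Complex.finite_leftEdge_zeros ha hT.le hf hcorner' hcorner).subset
      fun u hu ↦ ⟨hu.1, Ioo_subset_Icc_self hu.2⟩
  set S : Finset ℝ := Finset.image sz Finset.univ with hS
  have hScard : S.card = m := by
    rw [hS, Finset.card_image_of_injective _ hsz_mono.injective]
    simp
  have hSsub : S ⊆ hfin.toFinset := by
    intro u hu
    rw [hS, Finset.mem_image] at hu
    obtain ⟨j, -, rfl⟩ := hu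
    rw [Set.Finite.mem_toFinset]
    refine ⟨by rw [e0]; exact hsz_zero j, ?_, ?_⟩
    · exact lt_trans (ht_lo _) (hsz_mem j).1
    · exact lt_trans (hsz_mem j).2 (ht_hi _)
  -- each term is ≥ 0, and ≥ 1 at a zero
  have hK : ∀ u ∈ hfin.toFinset, (((0 : ℝ) : ℂ) + u * I) ∈ Icc 0 a₀ ×ℂ Icc T₁ T₂ := by
    intro u hu
    rw [Set.Finite.mem_toFinset] at hu
    rw [e0]; exact hmem u (Ioo_subset_Icc_self hu.2)
  have hnonneg : ∀ u ∈ hfin.toFinset, (0 : ℝ) ≤ ((meromorphicOrderAt f ((0 : ℝ) + u * I)).untop₀ : ℝ) := by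
    intro u hu
    rw [(hf _ (hK u hu)).meromorphicOrderAt_eq]
    cases h : analyticOrderAt f (((0 : ℝ) : ℂ) + u * I) with
    | top => simp
    | coe n => simp
  have hone : ∀ u ∈ hfin.toFinset, (1 : ℝ) ≤ ((meromorphicOrderAt f ((0 : ℝ) + u * I)).untop₀ : ℝ) := by
    intro u hu
    have huK := hK u hu
    rw [Set.Finite.mem_toFinset] at hu
    have hne := Literature.Analysis.Complex.analyticOrderAt_ne_top_of_reProdIm ha hT.le hf
      hcorner' hcorner huK
    rw [(hf _ huK).meromorphicOrderAt_eq]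
    cases h : analyticOrderAt f (((0 : ℝ) : ℂ) + u * I) with
    | top => exact absurd h hne
    | coe n =>
      have hn : n ≠ 0 := by
        intro hn0
        rw [hn0] at h
        exact ((hf _ huK).analyticOrderAt_eq_zero.mp (by exact_mod_cast h)) hu.1
      have h1 : (1 : ℝ) ≤ n := by exact_mod_cast Nat.one_le_iff_ne_zero.mpr hn
      simpa using h1
  rw [finsum_mem_eq_finite_toFinset_sum _ hfin]
  calc (m : ℝ) = ∑ u ∈ S, (1 : ℝ) := by simp [hScard]
    _ ≤ ∑ u ∈ S, ((meromorphicOrderAt f ((0 : ℝ) + u * I)).untop₀ : ℝ) :=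
        Finset.sum_le_sum fun u hu ↦ hone u (hSsub hu)
    _ ≤ ∑ u ∈ hfin.toFinset, ((meromorphicOrderAt f ((0 : ℝ) + u * I)).untop₀ : ℝ) :=
        Finset.sum_le_sum_of_subset_of_nonneg hSsub fun u hu _ ↦ hnonneg u hu

/-- **Cone edges.** If along a horizontal edge both arc pieces `U(x+iT)` and `conj U(-x+iT)` lie
in the open cone of half-angle `θ < π/2` about a direction `d` (`‖d‖ = 1`), then so does their sum
`f`, hence `f ≠ 0` there and the argument swing `|Im ∫ f'/f|` along the edge is `≤ 2θ`
(principal log after rotating by `d⁻¹`; `integral_logDeriv_horizontal`). Stated for the sum. -/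
theorem horizontal_swing_le_of_cone {f : ℂ → ℂ} {a₀ T θ : ℝ} {d : ℂ} (hd : ‖d‖ = 1)
    (hθ : 0 ≤ θ) (hθ' : θ < Real.pi / 2) (ha : 0 ≤ a₀)
    (hf : ∀ x ∈ Icc 0 a₀, AnalyticAt ℂ f (x + T * I))
    (hcone : ∀ x ∈ Icc 0 a₀, ‖f (x + T * I)‖ * Real.cos θ < (f (x + T * I) * (starRingEnd ℂ d)).re) :
    (∀ x ∈ Icc 0 a₀, f (x + T * I) ≠ 0) ∧
      |(∫ x in (0 : ℝ)..a₀, deriv f (x + T * I) / f (x + T * I)).im| ≤ 2 * θ := by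
  have hdne : (starRingEnd ℂ d) ≠ 0 := by
    intro h0
    have : ‖d‖ = 0 := by simpa using congrArg norm h0
    rw [hd] at this
    exact one_ne_zero this
  -- non-vanishing on the edge
  have hne : ∀ x ∈ Icc 0 a₀, f (x + T * I) ≠ 0 := by
    intro x hx h0
    have := hcone x hx
    rw [h0] at this
    simp at this
  refine ⟨hne, ?_⟩
  -- the rotated function g = f · conj d takes values in the right half-plane on the edge
  set g : ℂ → ℂ := fun z ↦ f z * (starRingEnd ℂ d) with hg_def
  have hg_an : ∀ x ∈ Icc 0 a₀, AnalyticAt ℂ g (x + T * I) := fun x hx ↦ (hf x hx).mul analyticAt_const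
  have hg_re : ∀ x ∈ Icc 0 a₀, ‖g (x + T * I)‖ * Real.cos θ < (g (x + T * I)).re := by
    intro x hx
    have h1 : ‖g (x + T * I)‖ = ‖f (x + T * I)‖ := by
      simp [hg_def, hd]
    rw [h1]
    exact hcone x hx
  have hcos : 0 < Real.cos θ := Real.cos_pos_of_mem_Ioo ⟨by linarith, hθ'⟩
  have hg_pos : ∀ x ∈ Icc 0 a₀, 0 < (g (x + T * I)).re := fun x hx ↦
    lt_of_le_of_lt (by positivity) (hg_re x hx)
  have hg_slit : ∀ x ∈ Icc 0 a₀, g (x + T * I) ∈ slitPlane := fun x hx ↦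
    Complex.mem_slitPlane_iff.mpr (Or.inl (hg_pos x hx))
  -- |arg| ≤ θ in the cone
  have harg : ∀ x ∈ Icc 0 a₀, |Complex.arg (g (x + T * I))| ≤ θ := by
    intro x hx
    set z := g (x + T * I) with hz
    have hre : ‖z‖ * Real.cos θ < z.re := hg_re x hx
    have hzpos : 0 < z.re := hg_pos x hx
    have hz0 : z ≠ 0 := fun h ↦ by rw [h] at hzpos; simp at hzpos
    have hnorm : 0 < ‖z‖ := norm_pos_iff.mpr hz0
    have hsin : 0 ≤ Real.sin θ := Real.sin_nonneg_of_nonneg_of_le_pi hθ (by linarith [Real.pi_pos])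
    -- |Im z| ≤ ‖z‖ sin θ
    have hsq : ‖z‖ ^ 2 = z.re ^ 2 + z.im ^ 2 := by
      rw [← Complex.normSq_eq_norm_sq, Complex.normSq_apply]; ring
    have hcs : Real.cos θ ^ 2 + Real.sin θ ^ 2 = 1 := Real.cos_sq_add_sin_sq θ
    have him_sq : z.im ^ 2 ≤ (‖z‖ * Real.sin θ) ^ 2 := by
      have h1 : (‖z‖ * Real.cos θ) ^ 2 < z.re ^ 2 := by
        have h0 : 0 ≤ ‖z‖ * Real.cos θ := by positivity
        nlinarith
      nlinarith
    have him : |z.im| ≤ ‖z‖ * Real.sin θ := by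
      have h0 : 0 ≤ ‖z‖ * Real.sin θ := by positivity
      exact abs_le_of_sq_le_sq' him_sq h0 |>.elim (fun h1 h2 ↦ abs_le.mpr ⟨h1, h2⟩)
    have hquot : |z.im / ‖z‖| ≤ Real.sin θ := by
      rw [abs_div, abs_of_pos hnorm, div_le_iff₀ hnorm]
      linarith [him]
    rw [Complex.arg_of_re_nonneg hzpos.le]
    have hq1 := (abs_le.mp hquot).1
    have hq2 := (abs_le.mp hquot).2
    have hθ2 : θ ≤ Real.pi / 2 := hθ'.le
    have hθ1 : -(Real.pi / 2) ≤ θ := by linarith [Real.pi_pos]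
    rw [abs_le]
    constructor
    · have := Real.arcsin_le_arcsin hq1
      rwa [show -Real.sin θ = Real.sin (-θ) by rw [Real.sin_neg],
        Real.arcsin_sin (by linarith) (by linarith)] at this
    · have := Real.arcsin_le_arcsin hq2
      rwa [Real.arcsin_sin hθ1 hθ2] at this
  -- the integral of g'/g = f'/f is a difference of principal logarithms
  have hint := Literature.Analysis.Complex.integral_logDeriv_horizontal (g := g) T ha hg_an hg_slit
  have hcongr : (∫ x in (0 : ℝ)..a₀, deriv f (x + T * I) / f (x + T * I)) =
      ∫ x in (0 : ℝ)..a₀, deriv g (x + T * I) / g (x + T * I) := by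
    refine intervalIntegral.integral_congr fun x hx ↦ ?_
    have hx' : x ∈ Icc 0 a₀ := by rwa [uIcc_of_le ha] at hx
    have hdg : deriv g (x + T * I) = deriv f (x + T * I) * (starRingEnd ℂ d) := by
      rw [hg_def]
      exact ((hf x hx').differentiableAt.hasDerivAt.mul_const _).deriv
    rw [hdg]
    simp only [hg_def]
    rw [mul_div_mul_right _ _ hdne]
  rw [hcongr, hint, Complex.sub_im, Complex.log_im, Complex.log_im]
  have h1 := harg a₀ ⟨ha, le_rfl⟩
  have h2 := harg 0 ⟨le_rfl, ha⟩
  simp only [Complex.ofReal_zero] at h2 ⊢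
  have := abs_sub (Complex.arg (g (↑a₀ + ↑T * I))) (Complex.arg (g (0 + ↑T * I)))
  linarith [abs_le.mp h1, abs_le.mp h2, (abs_le.mp h1).1, (abs_le.mp h2).2,
    abs_sub_le_iff.mp (le_refl |Complex.arg (g (↑a₀ + ↑T * I)) - Complex.arg (g (0 + ↑T * I))|)]

end Summit.RiemannHypothesis.RiemannHypothesis.Theorems.JensenPolynomials.LogBand.PhaseCell
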